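import Summits.BirchSwinnertonDyer.BirchSwinnertonDyer.Theorems.CMKolyvaginAtInertTwoPairCurrencyAtTwoPure
import Summits.BirchSwinnertonDyer.BirchSwinnertonDyer.Theorems.CMKolyvaginAtInertTwoCebotarevBinderAlgebra
import Summits.BirchSwinnertonDyer.BirchSwinnertonDyer.Theorems.CMKolyvaginAtInertTwoCebotarevLeafAtTwoPowHom
import HarnessLib

/-!
# Route `CMKolyvaginAtInertTwo`, crux `CMKolyvaginExactAtInertTwo` (stmt-BirchSwinnertonDyer-24277):
# T4c — THE ORDER-FORM ČEBOTAREV BINDER `hCeb₂` AT `p = 2` IN THE EIGEN-PAIR CURRENCY, from the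
# dependent-family leaf (p669091), the realisability criterion (p670347) and a regular element of `E[2^M]`

Seat `bsd-line-cmk2-p1` g13 (cell `bsd-print-cf2`); helper (`--supports stmt-BirchSwinnertonDyer-24277`).
THEOREMS ONLY: no definition, no named fact, no `sorry`; no item is closed; BSD is not proved by this.

`cebotarev_binder_pair` is the hypothesis `hCeb₂` of the adaptive telescope
(`KolyvaginAdaptiveData.card_mul_card_le_of_casselsTate_adaptive`, p673519) for the `p = 2` instance
`KolyvaginPairDataTwo.pairData` (p675421) — its `eig`, `A`, `Kol`, `Δ` being `pairEig`, `pairA`,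
"Gross-form Kolyvagin prime of `(2, M)` with `S ℓ`", `pairDelta` —, with `S.expo g₁` replaced by an
exponent `e₁` with `ord g₁ = 2^{e₁}` (`SplitDataM.addOrderOf_eq_pow_expo`). GIVEN: the Čebotarev inputs
of the leaf `KolyvaginImageTwo.exists_kolyvaginPrime_gt_two_pow_of_hom` (`ρ̄_{E,2}` onto, `Δ_E ∉ K²`, a
complex conjugation `c₀`, the Cartan-type `z` with `hcomm`), a support `S` containing every Gross-form
Kolyvagin prime of `(2, M)` (on H₂: `CMInert`, g6's `cmInert_of_isKolyvaginPrime_two`), and a REGULAR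
element `m₀ ∈ E[2^M]`: `m₀ ± τm₀` both of order `2^M` (`E[2^M] ≅ ℤ/2^M[τ]`, g10).
PROOF. Push `T ∪ {g₁, g₂}` to `H¹(K, E[2^M])` by `pairEmb` (pure classes keep sign and order; `Δ`
dies); in the finite span `C` run `KolyvaginCebotarevTwo.exists_characters_optional` (pools = images
of the two halves of `T`, `b = g₁`, `c = 2^{I−1} g₂`; its two hypotheses are exactly (H1)/(H2) pulled
back through `pairEmb`, `Δ = ker`), get `ψ₁, ψ₂ : C → ℤ/2^M`; feed the leaf with
`ψ = Aψ₁ + B(σ₀ψ₂)`, `A a = a m₀`, `B a = a τm₀` (`σ₀ = −ν`); at the resulting Kolyvagin prime the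
value `[x, F] = ν_x τψ(x) + ψ(x)` of a class of sign `ν_x` is `(A + ν_x B)(χ_{ν_x}(x))`
(`KolyvaginCebotarevTwo.conj_smul_eval_add_eval`), `χ_{σ₀} = ψ₁ + ψ₂`, `χ_{−σ₀} = ψ₁ − ψ₂`, and
`A ± B` is injective (regularity of `m₀`); McCallum's (3) (`x_λ = 0 ⟺ [x, F] = 0` on `C`) converts the
character values into the three conclusions (pool zero; `g₁` full; `ord g₂,λ ≥ 2^I`).
References: [McCallumLMS1991] §3 (2), (3), Prop. 3.1, Cor. 3.2; §5 Thm. 5.4 (21)–(23);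
[GrossLMS1991] §9; [Kolyvagin1989Izv] §3.
-/

-- single-conjunct summit: `Summit.BirchSwinnertonDyer.BirchSwinnertonDyer.…` repeats the name by design
set_option linter.dupNamespace false
set_option autoImplicit false

noncomputable section

open scoped Classical
open WeierstrassCurve NumberField IsDedekindDomain Field
open Literature.NumberTheory.GaloisRepresentations
open Literature.NumberTheory.EllipticCurves Literature.NumberTheory.EllipticCurves.KolyvaginDescent

namespace Summit.BirchSwinnertonDyer.BirchSwinnertonDyer.Theorems.KolyvaginPairDataTwo

open KolyvaginCebotarevTwo KolyvaginImageTwo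

-- the product-of-subtypes carrier `PairV` makes instance unification slow (`addOrderOf`, `•`)
set_option maxHeartbeats 800000 in
/-- **T4c: the order-form Čebotarev binder at `p = 2` (the hypothesis `hCeb₂` of the adaptive
telescope for the instance `pairData`, exponent form).** See the module docstring for the inputs and
the proof. Conclusion: for every bound `b₀` a Gross-form Kolyvagin prime `ℓ > b₀` of `(2, M)` with `S ℓ`
such that the pool `⟨T⟩` lies in `pairA ℓ` (its classes vanish at `λ`), `2^j g₁ ∉ pairA ℓ` for
`j < e₁` (`g₁` has full order at `λ`), and `2^i g₂ ∉ pairA ℓ` for `i < I` (`ord g₂,λ ≥ 2^I`).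
[cite: McCallumLMS1991, §3 (2), (3), Prop. 3.1, Cor. 3.2; §5 Thm. 5.4 (21)–(23) (PDF pp. 279–280, 289)]
[cite: GrossLMS1991, §9 (Props. 9.3, 9.6 and the density argument)] -/
theorem cebotarev_binder_pair
    (hC : Literature.NumberTheory.Automorphic.chebotarev_artinRep)
    {N : ℕ} [NeZero N] (W : WeierstrassCurve ℚ) [W.IsElliptic] {K : Type} [Field K] [NumberField K]
    (hK : IsImaginaryQuadratic K) (hρ : W.HasSurjectiveModNGaloisRep 2)
    (hΔK : ¬ IsSquare (W.baseChange K).Δ) {c : K ≃ₐ[ℚ] K} (hc : c ≠ 1)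
    {c₀ : absoluteGaloisGroup ℚ} (hc₀ : IsComplexConjugation (Rat.castHom ℝ) c₀)
    {M : ℕ} (hM : 1 ≤ M) {z : absoluteGaloisGroup K}
    (hzfix : ∀ P : geomTorsion (W.baseChange K) ((2 : ℕ) : ℤ), z • P = P → P = 0)
    (hcomm : ∀ π ∈ torsionFixing (W.baseChange K) ((2 : ℕ) : ℤ),
      ∀ P : geomTorsion (W.baseChange K) ((2 ^ M : ℕ) : ℤ), π • z • P = z • π • P)
    {S : ℕ → Prop} (hS : ∀ ℓ, IsKolyvaginPrime N W K 2 ℓ → FrobEqFrobInfty W K (2 ^ M) ℓ → S ℓ)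
    (m₀ : geomTorsion (W.baseChange K) ((2 ^ M : ℕ) : ℤ))
    (hm : ∀ s : ℤ, s = 1 ∨ s = -1 → ∀ k : ℤ,
      k • (m₀ + s • (RatClosure.isLiftOfAut_absGaloisTransport_of_isImaginaryQuadratic hK hc hc₀).torsionMap
        W ((2 ^ M : ℕ) : ℤ) m₀) = 0 → ((2 ^ M : ℕ) : ℤ) ∣ k)
    {ε : ℤ} (hε : ε = 1 ∨ ε = -1)
    (T : Finset (PairV W c M ε)) (g₁ g₂ : PairV W c M ε) (ν : ℤ) (I e₁ : ℕ) (hν : ν = 1 ∨ ν = -1)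
    (hg₁ : g₁ ∈ pairEig W c M ε ν) (hg₂ : g₂ ∈ pairEig W c M ε (-ν))
    (hT : ∀ t ∈ T, ∃ e : ℤ, (e = 1 ∨ e = -1) ∧ t ∈ pairEig W c M ε e)
    (he₁ : addOrderOf g₁ = 2 ^ e₁)
    (H1 : g₁ ≠ 0 → (((2 : ℕ) : ℤ) ^ (e₁ - 1)) • g₁ ∉
      pairDelta W c M ε ⊔ AddSubgroup.closure (T : Set (PairV W c M ε)))
    (H2 : 1 ≤ I → ∀ d ∈ pairDelta W c M ε, ∀ u ∈ AddSubgroup.closure (T : Set (PairV W c M ε)),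
      u ∈ pairEig W c M ε (-ν) → ∀ v ∈ AddSubgroup.closure (T : Set (PairV W c M ε)),
      v ∈ pairEig W c M ε ν → ((2 : ℕ) : ℤ) • v = 0 → (((2 : ℕ) : ℤ) ^ (I - 1)) • g₂ ≠ d + u + v)
    (b₀ : ℕ) :
    ∃ ℓ : ℕ, b₀ < ℓ ∧ (IsKolyvaginPrime N W K 2 ℓ ∧ FrobEqFrobInfty W K (2 ^ M) ℓ ∧ S ℓ) ∧
      (∀ t ∈ AddSubgroup.closure (T : Set (PairV W c M ε)), t ∈ pairA (N := N) W c M ε ℓ) ∧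
      (∀ j < e₁, (((2 : ℕ) : ℤ) ^ j) • g₁ ∉ pairA (N := N) W c M ε ℓ) ∧
      (∀ i < I, (((2 : ℕ) : ℤ) ^ i) • g₂ ∉ pairA (N := N) W c M ε ℓ) := by
  haveI : NeZero (2 ^ M) := ⟨pow_ne_zero _ two_ne_zero⟩
  have ht := RatClosure.isLiftOfAut_absGaloisTransport_of_isImaginaryQuadratic hK hc hc₀
  have hinv : ∀ x, (absGaloisTransport (K := ℚ) (L := K) c₀).toRingEquiv
      ((absGaloisTransport (K := ℚ) (L := K) c₀).toRingEquiv x) = x := fun x ↦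
    RatClosure.absGaloisTransport_absGaloisTransport_of_sq_eq_one hc₀.sq_eq_one x
  -- signs
  set σ₀ : ℤ := -ν with hσ₀
  have hσ₀1 : σ₀ = 1 ∨ σ₀ = -1 := by rcases hν with h | h <;> simp [hσ₀, h]
  -- purity of all classes involved
  have hpureT : ∀ t ∈ T, t.2 = 0 ∨ t.1 = 0 := fun t htT ↦ by
    obtain ⟨e, -, he⟩ := hT t htT
    exact snd_eq_zero_or_fst_eq_zero_of_mem_pairEig W c M ε he
  have hpure₁ : g₁.2 = 0 ∨ g₁.1 = 0 := snd_eq_zero_or_fst_eq_zero_of_mem_pairEig W c M ε hg₁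
  have hpure₂ : g₂.2 = 0 ∨ g₂.1 = 0 := snd_eq_zero_or_fst_eq_zero_of_mem_pairEig W c M ε hg₂
  -- ### the family: `T ∪ {g₁, g₂}` pushed to `H¹(K, E[2^M])`
  set L : Finset (PairV W c M ε) := insert g₁ (insert g₂ T) with hL
  have hpureL : ∀ v ∈ L, v.2 = 0 ∨ v.1 = 0 := by
    intro v hv
    rw [hL, Finset.mem_insert, Finset.mem_insert] at hv
    rcases hv with rfl | rfl | hv
    exacts [hpure₁, hpure₂, hpureT v hv]
  have hg₁L : g₁ ∈ L := by rw [hL]; exact Finset.mem_insert_self _ _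
  have hg₂L : g₂ ∈ L := by
    rw [hL]; exact Finset.mem_insert_of_mem (Finset.mem_insert_self _ _)
  have hTL : ∀ t ∈ T, t ∈ L := fun t htT ↦ by
    rw [hL]; exact Finset.mem_insert_of_mem (Finset.mem_insert_of_mem htT)
  set e : Fin L.card ≃ ↥L := L.equivFin.symm with hedef
  -- (`cs` kept OPAQUE: a transparent definition makes `isDefEq` unfold `pairEmb` and time out)
  obtain ⟨cs, hcs⟩ : ∃ cs : Fin L.card → galH1Torsion (W.baseChange K) ((2 ^ M : ℕ) : ℤ),
      ∀ i, cs i = pairEmb W c M ε (e i : PairV W c M ε) := ⟨_, fun _ ↦ rfl⟩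
  set νf : Fin L.card → ℤ := fun i ↦ if (e i : PairV W c M ε).2 = 0 then ε else -ε with hνf
  have hτcs : ∀ i, conjAct W c ((2 ^ M : ℕ) : ℤ) (cs i) = νf i • cs (id i) := fun i ↦ by
    show conjAct W c ((2 ^ M : ℕ) : ℤ) (cs i) = νf i • cs i
    rw [hcs]
    exact conjAct_pairEmb W c M (hpureL _ (e i).2)
  have hidx : ∀ v, v ∈ L → ∃ i : Fin L.card, (e i : PairV W c M ε) = v := fun v hv ↦
    ⟨e.symm ⟨v, hv⟩, by rw [Equiv.apply_symm_apply]⟩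
  set C := AddSubgroup.closure (Set.range cs) with hCdef
  have hmemC : ∀ v, v ∈ L → pairEmb W c M ε v ∈ C := by
    intro v hv
    obtain ⟨i, hi⟩ := hidx v hv
    rw [← hi, ← hcs]
    exact AddSubgroup.subset_closure ⟨i, rfl⟩
  -- `C` is a finite abelian group killed by `2^M`
  haveI : AddGroup.FG C := AddGroup.closure_finite_fg _
  have htor : AddMonoid.IsTorsion C := fun x ↦ by
    rw [isOfFinAddOrder_iff_nsmul_eq_zero]
    refine ⟨2 ^ M, pow_pos two_pos M, Subtype.ext ?_⟩
    rw [AddSubgroupClass.coe_nsmul, ZeroMemClass.coe_zero, ← natCast_zsmul]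
    exact zsmul_galH1Torsion_eq_zero (W.baseChange K) ((2 ^ M : ℕ) : ℤ) x.1
  haveI : Finite C := AddCommGroup.finite_of_fg_torsion C htor
  have hCtor : ∀ x : C, 2 ^ M • x = 0 := fun x ↦ Subtype.ext (by
    rw [AddSubgroupClass.coe_nsmul, ZeroMemClass.coe_zero, ← natCast_zsmul]
    exact zsmul_galH1Torsion_eq_zero (W.baseChange K) ((2 ^ M : ℕ) : ℤ) x.1)
  -- ### the pools, `b` and `c` in `C`
  set Tp : Set (PairV W c M ε) := {t | t ∈ T ∧ (if t.2 = 0 then ε else -ε) = σ₀} with hTp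
  set Tm : Set (PairV W c M ε) := {t | t ∈ T ∧ (if t.2 = 0 then ε else -ε) = -σ₀} with hTm
  set Zp : AddSubgroup C := ((AddSubgroup.closure Tp).map (pairEmb W c M ε)).comap C.subtype with hZp
  set Zm : AddSubgroup C := ((AddSubgroup.closure Tm).map (pairEmb W c M ε)).comap C.subtype with hZm
  set bC : C := ⟨pairEmb W c M ε g₁, hmemC g₁ hg₁L⟩ with hbC
  set x₂ : C := ⟨pairEmb W c M ε g₂, hmemC g₂ hg₂L⟩ with hx₂
  set cC : C := (((2 : ℕ) : ℤ) ^ (I - 1)) • x₂ with hcC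
  -- lifting pool elements back to `V`, inside the right eigengroup
  have hTp_sub : AddSubgroup.closure Tp ≤ AddSubgroup.closure (T : Set (PairV W c M ε)) :=
    AddSubgroup.closure_mono fun t ht' ↦ ht'.1
  have hTm_sub : AddSubgroup.closure Tm ≤ AddSubgroup.closure (T : Set (PairV W c M ε)) :=
    AddSubgroup.closure_mono fun t ht' ↦ ht'.1
  have hTp_eig : ∀ u ∈ AddSubgroup.closure Tp, u ∈ pairEig W c M ε σ₀ := by
    refine fun u hu ↦ (AddSubgroup.closure_le (K := pairEig W c M ε σ₀)).mpr (fun t ht' ↦ ?_) hu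
    have h := mem_pairEig_sgn W c M hε (hpureT t ht'.1)
    rw [ht'.2] at h
    exact h
  have hTm_eig : ∀ u ∈ AddSubgroup.closure Tm, u ∈ pairEig W c M ε (-σ₀) := by
    refine fun u hu ↦ (AddSubgroup.closure_le (K := pairEig W c M ε (-σ₀))).mpr (fun t ht' ↦ ?_) hu
    have h := mem_pairEig_sgn W c M hε (hpureT t ht'.1)
    rw [ht'.2] at h
    exact h
  have hliftp : ∀ u : C, u ∈ Zp → ∃ u' ∈ AddSubgroup.closure Tp, pairEmb W c M ε u' = u.1 := by
    intro u hu
    obtain ⟨u', hu', hu'eq⟩ := AddSubgroup.mem_map.mp (AddSubgroup.mem_comap.mp hu)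
    exact ⟨u', hu', hu'eq⟩
  have hliftm : ∀ v : C, v ∈ Zm → ∃ v' ∈ AddSubgroup.closure Tm, pairEmb W c M ε v' = v.1 := by
    intro v hv
    obtain ⟨v', hv', hv'eq⟩ := AddSubgroup.mem_map.mp (AddSubgroup.mem_comap.mp hv)
    exact ⟨v', hv', hv'eq⟩
  have hνσ₀ : -σ₀ = ν := by rw [hσ₀, neg_neg]
  -- ### the criterion's hypotheses from (H1), (H2)
  have hcA : 1 ≤ I → ∀ u ∈ Zp, ∀ v ∈ Zm, 2 • v = 0 → cC ≠ u + v := by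
    intro hI u hu v hv h2v heq
    obtain ⟨u', hu', hu'eq⟩ := hliftp u hu
    obtain ⟨v', hv', hv'eq⟩ := hliftm v hv
    have hv'ν : v' ∈ pairEig W c M ε ν := hνσ₀ ▸ hTm_eig v' hv'
    -- `2 v' = 0`: its image is `2 v = 0` and `pairEmb` is injective on the eigengroup
    have h2v' : ((2 : ℕ) : ℤ) • v' = 0 := by
      refine eq_zero_of_pairEmb_eq_zero W c M hε ((pairEig W c M ε ν).zsmul_mem hv'ν _) ?_
      rw [map_zsmul, hv'eq, ← AddSubgroupClass.coe_zsmul]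
      have : ((2 : ℕ) : ℤ) • v = 0 := by rw [← natCast_zsmul] at h2v; exact h2v
      rw [this, ZeroMemClass.coe_zero]
    -- `d := 2^{I-1} g₂ - u' - v' ∈ Δ`
    have hd : (((2 : ℕ) : ℤ) ^ (I - 1)) • g₂ - u' - v' ∈ pairDelta W c M ε := by
      rw [mem_pairDelta_iff_pairEmb, map_sub, map_sub, hu'eq, hv'eq, map_zsmul]
      have := congrArg Subtype.val heq
      rw [AddSubgroup.coe_add] at this
      rw [sub_sub, sub_eq_zero, ← this, hcC, AddSubgroupClass.coe_zsmul]
    have hsum : (((2 : ℕ) : ℤ) ^ (I - 1)) • g₂ = (((2 : ℕ) : ℤ) ^ (I - 1)) • g₂ - u' - v' + u' + v' := by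
      rw [sub_sub, add_assoc, sub_add_cancel]
    exact H2 hI _ hd u' (hTp_sub hu') (hTp_eig u' hu') v' (hTm_sub hv') hv'ν h2v' hsum
  have hb : g₁ ≠ 0 → bC ≠ 0 := fun hg h ↦
    hg (eq_zero_of_pairEmb_eq_zero W c M hε hg₁ (congrArg Subtype.val h))
  have hordb : addOrderOf bC = 2 ^ e₁ := by
    rw [← he₁, ← addOrderOf_pairEmb W c M hpure₁]
    exact (AddSubgroup.addOrderOf_coe bC).symm
  have hB : g₁ ≠ 0 → ∀ u ∈ Zp, ∀ v ∈ Zm, 2 • u = 0 → 2 • v = 0 →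
      (addOrderOf bC / 2) • bC ≠ u + v := by
    intro hg u hu v hv _ _ heq
    obtain ⟨u', hu', hu'eq⟩ := hliftp u hu
    obtain ⟨v', hv', hv'eq⟩ := hliftm v hv
    have he₁pos : e₁ ≠ 0 := by
      intro h0
      rw [h0, pow_zero, AddMonoid.addOrderOf_eq_one_iff] at he₁
      exact hg he₁
    have hdiv : addOrderOf bC / 2 = 2 ^ (e₁ - 1) := by
      rw [hordb]
      obtain ⟨k, hk⟩ := Nat.exists_eq_succ_of_ne_zero he₁pos
      rw [hk, pow_succ, Nat.mul_div_cancel _ two_pos, Nat.succ_sub_one]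
    apply H1 hg
    -- `2^{e₁-1} g₁ = (2^{e₁-1} g₁ - u' - v') + (u' + v')`, the first summand in `Δ`
    have hd : (((2 : ℕ) : ℤ) ^ (e₁ - 1)) • g₁ - u' - v' ∈ pairDelta W c M ε := by
      rw [mem_pairDelta_iff_pairEmb, map_sub, map_sub, hu'eq, hv'eq, map_zsmul]
      have := congrArg Subtype.val heq
      rw [AddSubgroup.coe_add, hdiv, AddSubgroupClass.coe_nsmul, ← natCast_zsmul,
        Nat.cast_pow 2 (e₁ - 1)] at this
      rw [sub_sub, sub_eq_zero, ← this]
    have hsum : (((2 : ℕ) : ℤ) ^ (e₁ - 1)) • g₁ =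
        ((((2 : ℕ) : ℤ) ^ (e₁ - 1)) • g₁ - u' - v') + (u' + v') := by
      rw [sub_sub, sub_add_cancel]
    rw [hsum]
    exact AddSubgroup.add_mem _ (AddSubgroup.mem_sup_left hd)
      (AddSubgroup.mem_sup_right (AddSubgroup.add_mem _ (hTp_sub hu') (hTm_sub hv')))
  -- ### the characters
  obtain ⟨ψ₁, ψ₂, hZp0, hZm0, hcval, hbord⟩ :=
    exists_characters_optional hM hCtor Zp Zm bC cC (g₁ ≠ 0) (1 ≤ I) hcA hb hB
  -- ### `ψ = A ψ₁ + B (σ₀ ψ₂)` with `A a = a m₀`, `B a = a τm₀`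
  set τt := ht.torsionMap W ((2 ^ M : ℕ) : ℤ) with hτt
  have hq0 : ∀ m : geomTorsion (W.baseChange K) ((2 ^ M : ℕ) : ℤ), ((2 ^ M : ℕ) : ℤ) • m = 0 :=
    fun m ↦ Subtype.ext (by
      rw [AddSubgroupClass.coe_zsmul, ZeroMemClass.coe_zero]
      exact (mem_geomTorsion_iff _ _ _).mp m.2)
  set A : ZMod (2 ^ M) →+ geomTorsion (W.baseChange K) ((2 ^ M : ℕ) : ℤ) :=
    ZMod.lift (2 ^ M) ⟨zmultiplesHom _ m₀, by
      show (zmultiplesHom _ m₀) ((2 ^ M : ℕ) : ℤ) = 0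
      rw [zmultiplesHom_apply]; exact hq0 m₀⟩ with hA
  set B : ZMod (2 ^ M) →+ geomTorsion (W.baseChange K) ((2 ^ M : ℕ) : ℤ) :=
    ZMod.lift (2 ^ M) ⟨zmultiplesHom _ (τt m₀), by
      show (zmultiplesHom _ (τt m₀)) ((2 ^ M : ℕ) : ℤ) = 0
      rw [zmultiplesHom_apply]; exact hq0 (τt m₀)⟩ with hB'
  have hAcoe : ∀ k : ℤ, A (k : ZMod (2 ^ M)) = k • m₀ := fun k ↦ by
    rw [hA, ZMod.lift_coe]; rfl
  have hBcoe : ∀ k : ℤ, B (k : ZMod (2 ^ M)) = k • τt m₀ := fun k ↦ by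
    rw [hB', ZMod.lift_coe]; rfl
  have hτA : ∀ a, τt (A a) = B a := fun a ↦ by
    rw [← ZMod.intCast_zmod_cast a, hAcoe, hBcoe, map_zsmul]
  have hτB : ∀ a, τt (B a) = A a := fun a ↦ by
    rw [← ZMod.intCast_zmod_cast a, hAcoe, hBcoe, map_zsmul, hτt,
      ht.torsionMap_torsionMap W hinv]
  -- `L_s = A + s B` is injective for `s = ±1` (regularity of `m₀`)
  have hLinj : ∀ s : ℤ, s = 1 ∨ s = -1 → ∀ a : ZMod (2 ^ M), (A + s • B) a = 0 → a = 0 := by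
    intro s hs a ha
    rw [← ZMod.intCast_zmod_cast a] at ha ⊢
    rw [AddMonoidHom.add_apply, AddMonoidHom.smul_apply, hAcoe, hBcoe, smul_comm s,
      ← smul_add] at ha
    exact (ZMod.intCast_zmod_eq_zero_iff_dvd _ _).mpr (hm s hs _ ha)
  set ψ : C →+ geomTorsion (W.baseChange K) ((2 ^ M : ℕ) : ℤ) := A.comp ψ₁ + B.comp (σ₀ • ψ₂) with hψ
  -- ### the Kolyvagin prime
  obtain ⟨ℓ, hbℓ, hℓ, hℓN, hℓD, hℓ2, hprime, hfrob, F, hF, hval, hloc⟩ :=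
    exists_kolyvaginPrime_gt_two_pow_of_hom hC (N := N) W hK hρ hΔK hc hc₀ hM hzfix hcomm cs id νf
      hτcs ψ b₀
  have hKol : IsKolyvaginPrime N W K 2 ℓ :=
    ⟨hℓ, hℓN, hℓD, hℓ2, hprime, FrobEqFrobInfty.of_dvd (dvd_pow_self 2 (Nat.one_le_iff_ne_zero.mp hM)) hfrob⟩
  -- the value at a generator, through the evaluation identity
  have hval' : ∀ i, h1Eval (W.baseChange K) ((2 ^ M : ℕ) : ℤ) (cs i) F =
      (A + νf i • B) ((ψ₁ + νf i • (σ₀ • ψ₂)) ⟨cs i, AddSubgroup.subset_closure ⟨i, rfl⟩⟩) := by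
    intro i
    have hνi : νf i = 1 ∨ νf i = -1 := by
      show (if (e i : PairV W c M ε).2 = 0 then ε else -ε) = 1 ∨
        (if (e i : PairV W c M ε).2 = 0 then ε else -ε) = -1
      split_ifs
      · exact hε
      · rcases hε with h | h <;> simp only [h] <;> decide
    rw [hval i]
    exact conj_smul_eval_add_eval A B τt hτA hτB ψ₁ (σ₀ • ψ₂) hνi _
  -- `x_λ = 0 ⟺ [x, F] = 0` at the place `λ = (ℓ)`, for `x ∈ C`
  have hloc' : ∀ x ∈ C, (x ∈ (W.baseChange K).torsionLocalKer (hKol.place.adicCompletion K) ((2 ^ M : ℕ) : ℤ) ↔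
      h1Eval (W.baseChange K) ((2 ^ M : ℕ) : ℤ) x F = 0) := fun x hx ↦ hloc x hx _ hKol.mem_place
  refine ⟨ℓ, hbℓ, ⟨hKol, hfrob, hS ℓ hKol hfrob⟩, ?_, ?_, ?_⟩
  · -- ### the pool vanishes at `λ`
    refine fun t htc ↦ (AddSubgroup.closure_le (K := pairA (N := N) W c M ε ℓ)).mpr (fun t htT ↦ ?_) htc
    obtain ⟨i, hi⟩ := hidx t (hTL t htT)
    have hti : pairEmb W c M ε t = cs i := by rw [hcs, hi]
    apply mem_pairA_of_pairEmb_mem W c M hKol (hpureT t htT)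
    rw [hloc' _ (hmemC t (hTL t htT)), hti, hval' i]
    -- the character value vanishes: `t` is in the pool of its sign
    have hνi : νf i = (if t.2 = 0 then ε else -ε) := by
      show (if (e i : PairV W c M ε).2 = 0 then ε else -ε) = _
      rw [hi]
    have hσσ : σ₀ * σ₀ = 1 := by rcases hσ₀1 with h | h <;> simp [h]
    by_cases hsg : (if t.2 = 0 then ε else -ε) = σ₀
    · have htZp : (⟨cs i, AddSubgroup.subset_closure ⟨i, rfl⟩⟩ : C) ∈ Zp := by
        refine AddSubgroup.mem_comap.mpr (AddSubgroup.mem_map.mpr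
          ⟨t, AddSubgroup.subset_closure ⟨htT, hsg⟩, ?_⟩)
        rw [AddSubgroup.coe_subtype, hti]
      have h0 := hZp0 _ htZp
      have hχ0 : (ψ₁ + νf i • (σ₀ • ψ₂)) ⟨cs i, AddSubgroup.subset_closure ⟨i, rfl⟩⟩ = 0 := by
        rw [hνi, hsg, smul_smul, hσσ, one_zsmul, AddMonoidHom.add_apply]
        exact h0
      rw [hχ0, map_zero]
    · have hsg' : (if t.2 = 0 then ε else -ε) = -σ₀ := by
        by_cases h2 : t.2 = 0
        · rw [if_pos h2] at hsg ⊢; omega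
        · rw [if_neg h2] at hsg ⊢; omega
      have htZm : (⟨cs i, AddSubgroup.subset_closure ⟨i, rfl⟩⟩ : C) ∈ Zm := by
        refine AddSubgroup.mem_comap.mpr (AddSubgroup.mem_map.mpr
          ⟨t, AddSubgroup.subset_closure ⟨htT, hsg'⟩, ?_⟩)
        rw [AddSubgroup.coe_subtype, hti]
      have h0 := hZm0 _ htZm
      have hχ0 : (ψ₁ + νf i • (σ₀ • ψ₂)) ⟨cs i, AddSubgroup.subset_closure ⟨i, rfl⟩⟩ = 0 := by
        rw [hνi, hsg', smul_smul, show -σ₀ * σ₀ = -1 by rw [neg_mul, hσσ], neg_one_zsmul,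
          AddMonoidHom.add_apply, AddMonoidHom.neg_apply, ← sub_eq_add_neg]
        exact h0
      rw [hχ0, map_zero]
  · -- ### `g₁` is full at `λ`
    intro j hj hmem
    have hg0 : g₁ ≠ 0 := by
      intro h0
      rw [h0, addOrderOf_zero] at he₁
      have : e₁ = 0 := by
        rcases Nat.pow_eq_one.mp he₁.symm with h | h
        · norm_num at h
        · exact h
      omega
    obtain ⟨i, hi⟩ := hidx g₁ hg₁L
    have hgi : pairEmb W c M ε g₁ = cs i := by rw [hcs, hi]
    have hνi : νf i = ν := by
      change (if (e i : PairV W c M ε).2 = 0 then ε else -ε) = ν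
      rw [hi]
      exact sgn_eq_of_mem_pairEig W c M hε hν hg₁ hg0
    -- `[2^j g₁, F] = (A + νB)(2^j χ(b))` with `χ = ψ₁ - ψ₂`, `ord χ(b) = ord b = 2^{e₁}`
    have hmemj : pairEmb W c M ε ((((2 : ℕ) : ℤ) ^ j) • g₁) ∈ C := by
      rw [map_zsmul]; exact C.zsmul_mem (hmemC g₁ hg₁L) _
    have hzero := (hloc' _ hmemj).mp (pairEmb_mem_torsionLocalKer_of_mem_pairA W c M hKol hmem)
    rw [map_zsmul, h1Eval_zsmul _ _ _ _ hF, hgi, hval' i, ← map_zsmul, hνi] at hzero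
    have hχ := hbord hg0
    have hinj := hLinj ν hν _ hzero
    rw [← map_zsmul] at hinj
    -- the character `ψ₁ + ν σ₀ ψ₂ = ψ₁ - ψ₂`
    have hchar : (ψ₁ + ν • (σ₀ • ψ₂)) = ψ₁ - ψ₂ := by
      rw [smul_smul, show ν * σ₀ = -1 by rcases hν with h | h <;> simp [hσ₀, h], neg_one_zsmul,
        sub_eq_add_neg]
    rw [hchar] at hinj
    have hbzs : ((((2 : ℕ) : ℤ) ^ j) • (⟨cs i, AddSubgroup.subset_closure ⟨i, rfl⟩⟩ : C)) =
        (((2 : ℕ) : ℤ) ^ j) • bC := by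
      apply Subtype.ext
      show (((2 : ℕ) : ℤ) ^ j) • cs i = (((2 : ℕ) : ℤ) ^ j) • pairEmb W c M ε g₁
      rw [hgi]
    rw [hbzs, map_zsmul, AddMonoidHom.sub_apply] at hinj
    exact zsmul_ne_zero_of_addOrderOf_eq_two_pow (hχ.trans hordb) hj hinj
  · -- ### `g₂` has local order `≥ 2^I`
    intro i₀ hi₀ hmem
    have hI : 1 ≤ I := by omega
    have hcne := hcval hI
    have hg0 : g₂ ≠ 0 := by
      intro h0
      apply hcne
      have : cC = 0 := by
        rw [hcC, hx₂]
        have : (⟨pairEmb W c M ε g₂, hmemC g₂ hg₂L⟩ : C) = 0 := Subtype.ext (by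
          show pairEmb W c M ε g₂ = ((0 : C) : galH1Torsion (W.baseChange K) ((2 ^ M : ℕ) : ℤ))
          rw [h0, map_zero]; rfl)
        rw [this, zsmul_zero]
      rw [this, map_zero, map_zero, add_zero]
    obtain ⟨i, hi⟩ := hidx g₂ hg₂L
    have hgi : pairEmb W c M ε g₂ = cs i := by rw [hcs, hi]
    have hν' : -ν = 1 ∨ -ν = -1 := by rcases hν with h | h <;> simp [h]
    have hνi : νf i = σ₀ := by
      change (if (e i : PairV W c M ε).2 = 0 then ε else -ε) = σ₀
      rw [hi, hσ₀]
      exact sgn_eq_of_mem_pairEig W c M hε hν' hg₂ hg0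
    have hmemj : pairEmb W c M ε ((((2 : ℕ) : ℤ) ^ i₀) • g₂) ∈ C := by
      rw [map_zsmul]; exact C.zsmul_mem (hmemC g₂ hg₂L) _
    have hzero := (hloc' _ hmemj).mp (pairEmb_mem_torsionLocalKer_of_mem_pairA W c M hKol hmem)
    rw [map_zsmul, h1Eval_zsmul _ _ _ _ hF, hgi, hval' i, ← map_zsmul, hνi] at hzero
    have hinj := hLinj σ₀ hσ₀1 _ hzero
    rw [← map_zsmul] at hinj
    have hchar : (ψ₁ + σ₀ • (σ₀ • ψ₂)) = ψ₁ + ψ₂ := by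
      rw [smul_smul, show σ₀ * σ₀ = 1 by rcases hσ₀1 with h | h <;> simp [h], one_zsmul]
    rw [hchar] at hinj
    have hxzs : ((((2 : ℕ) : ℤ) ^ i₀) • (⟨cs i, AddSubgroup.subset_closure ⟨i, rfl⟩⟩ : C)) =
        (((2 : ℕ) : ℤ) ^ i₀) • x₂ := by
      apply Subtype.ext
      show (((2 : ℕ) : ℤ) ^ i₀) • cs i = (((2 : ℕ) : ℤ) ^ i₀) • pairEmb W c M ε g₂
      rw [hgi]
    rw [hxzs, map_zsmul] at hinj
    -- `(ψ₁ + ψ₂)(2^{I-1} x₂) ≠ 0`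
    have hc' : (((2 : ℕ) : ℤ) ^ (I - 1)) • (ψ₁ + ψ₂) x₂ ≠ 0 := by
      rw [← map_zsmul, ← hcC, AddMonoidHom.add_apply]
      exact hcne
    exact zsmul_ne_zero_of_zsmul_ne_zero_of_lt hc' hi₀ hinj

end Summit.BirchSwinnertonDyer.BirchSwinnertonDyer.Theorems.KolyvaginPairDataTwo
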